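import Summits.MatrixMultiplication.MatrixMultiplication.Theorems.AbelianSTPPCensusFPQThree
import Summits.MatrixMultiplication.MatrixMultiplication.Theorems.AbelianSTPPCensusGW2Class

/-!
# Rule FPq at `p = 3` («FP3»): heavy-pair caps on level sets and the Grynkiewicz–Wang rows

Cell mm-stpp (rung F-M1), theory lane «past the walls» (seat mm-stpp-theory, gen 19).  Census-silent ENABLER, sequel of
`AbelianSTPPCensusFPQThree` (HOME/mm-stpp-theory/FP3-NOTE.md §6–§8: the rows of the proposed «FP3 certificate machine»).

A certificate against `FPQ.AdmG Λ (3·|Λ|) a b c` has to bound the number of solutions `g + h = c` between LEVEL SETS of two letters landing on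
the classes of the third.  At `p = 3` the only level sets are `{= 0}`, `{≥ 1}`, `{≥ 2}`, `{= 3}`, and the closed form of clause (F1)
(`three_floor_sum_le`: `Σ_g ⌊W·u_g·v_{c−g}/3⌋ ≤ W·cap` for a target class with `W ≥ 1` points) caps the heavy pairs at EVERY non-empty target
class, independently of `W`:
* `three_heavyheavy_le` — pairs `(≥2, ≥2)`: at most `cap`;  `three_fullheavy_le`, `three_heavyfull_le` — pairs `(3, ≥2)`, `(≥2, 3)`: at most `⌊cap/2⌋`;
  `three_fullfull_le` — pairs `(3, 3)`: at most `⌊cap/3⌋`.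
In the language of the tree's representation function (`repCount`, `GW2.repCount_eq_card_filter`) these say `r_{A,B}(c) ≤ κ` on `supp w` for the
level sets `A ∈ {G_u, F_u}`, `B ∈ {G_v, F_v}` (`repCount_levels_eq`).  Feeding such a cap into the tree's Grynkiewicz–Wang dichotomy
(`GW2.gw_dichotomy`, kernel GW26 Thm 1.8) gives the generic ROW `three_gw_row`: for finsets `A, B ⊆ Λ` with `r_{A,B} ≤ κ` on `supp w`, `κ < t`,
`2 ≤ t ≤ |A|, |B|`, either the FLOOR `t|A| + t|B| ≤ #supp w · min(t, κ) + t·#{w = 0} + ⌊(4t²−2t)/3⌋`, or the STRUCTURED branch: a divisor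
`d ≥ 2` of `|Λ|` (order of the period group of the `t`-popular set, which lies inside `{w = 0}`) with `|A| + |B| + 1 ≤ #{w = 0} + d + t` and
`t|A| + t|B| ≤ t·d + #supp w · min(t, κ) + t·#{w = 0}`.  Instances `three_gw_row_GG / _FG / _GF / _FF` for one letter form `FormOKG Λ 3 cap …`.
WHAT THIS IS NOT: no kill, no certificate, no census number, no `ω` statement; statements about the shape-level predicate only.
-/

set_option linter.dupNamespace false -- `MatrixMultiplication.MatrixMultiplication` (summit = problem, D-0017)
set_option autoImplicit false

namespace Summit.MatrixMultiplication.MatrixMultiplication.Theorems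

open Finset
open scoped Pointwise

namespace FPQ

variable {Λ : Type} [AddCommGroup Λ] [Fintype Λ] [DecidableEq Λ]
variable {cap vmin SU SV SW : ℕ} {u v w : Λ → ℕ}

/-! ### Heavy-pair caps at a non-empty target class (any `W ≥ 1`) -/

omit [DecidableEq Λ] in
/-- Pairs `(≥2, ≥2)` at a non-empty target class number at most `cap` (each costs `⌊W·a·b/3⌋ ≥ W`). [original] -/
theorem three_heavyheavy_le {c : Λ} {W : ℕ} (hT : TargetOKG Λ 3 cap vmin u v c W) (hW : 1 ≤ W)
    (hu : ∀ g, u g ≤ 3) (hv : ∀ g, v g ≤ 3) :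
    (univ.filter (fun g => 2 ≤ u g ∧ 2 ≤ v (c - g))).card ≤ cap := by
  have h := three_floor_sum_le hT hu hv
  have key : ∀ W ≤ 3, ∀ a ≤ 3, ∀ b ≤ 3, W * (if 2 ≤ a ∧ 2 ≤ b then 1 else 0) ≤ W * a * b / 3 := by decide
  refine Nat.le_of_mul_le_mul_left (le_trans ?_ h) hW
  rw [card_filter, mul_sum]
  exact sum_le_sum fun g _ => key W hT.1 (u g) (hu g) (v (c - g)) (hv (c - g))

omit [DecidableEq Λ] in
/-- Pairs `(3, ≥2)` at a non-empty target class number at most `⌊cap/2⌋` (each costs `≥ 2W`). [original] -/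
theorem three_fullheavy_le {c : Λ} {W : ℕ} (hT : TargetOKG Λ 3 cap vmin u v c W) (hW : 1 ≤ W)
    (hu : ∀ g, u g ≤ 3) (hv : ∀ g, v g ≤ 3) :
    2 * (univ.filter (fun g => u g = 3 ∧ 2 ≤ v (c - g))).card ≤ cap := by
  have h := three_floor_sum_le hT hu hv
  have key : ∀ W ≤ 3, ∀ a ≤ 3, ∀ b ≤ 3, W * (2 * if a = 3 ∧ 2 ≤ b then 1 else 0) ≤ W * a * b / 3 := by decide
  refine Nat.le_of_mul_le_mul_left (le_trans ?_ h) hW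
  rw [card_filter, mul_sum, mul_sum]
  exact sum_le_sum fun g _ => key W hT.1 (u g) (hu g) (v (c - g)) (hv (c - g))

omit [DecidableEq Λ] in
/-- Pairs `(≥2, 3)` at a non-empty target class number at most `⌊cap/2⌋`. [original] -/
theorem three_heavyfull_le {c : Λ} {W : ℕ} (hT : TargetOKG Λ 3 cap vmin u v c W) (hW : 1 ≤ W)
    (hu : ∀ g, u g ≤ 3) (hv : ∀ g, v g ≤ 3) :
    2 * (univ.filter (fun g => 2 ≤ u g ∧ v (c - g) = 3)).card ≤ cap := by
  have h := three_floor_sum_le hT hu hv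
  have key : ∀ W ≤ 3, ∀ a ≤ 3, ∀ b ≤ 3, W * (2 * if 2 ≤ a ∧ b = 3 then 1 else 0) ≤ W * a * b / 3 := by decide
  refine Nat.le_of_mul_le_mul_left (le_trans ?_ h) hW
  rw [card_filter, mul_sum, mul_sum]
  exact sum_le_sum fun g _ => key W hT.1 (u g) (hu g) (v (c - g)) (hv (c - g))

omit [DecidableEq Λ] in
/-- Pairs `(3, 3)` at a non-empty target class number at most `⌊cap/3⌋` (each costs `3W`). [original] -/
theorem three_fullfull_le {c : Λ} {W : ℕ} (hT : TargetOKG Λ 3 cap vmin u v c W) (hW : 1 ≤ W)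
    (hu : ∀ g, u g ≤ 3) (hv : ∀ g, v g ≤ 3) :
    3 * (univ.filter (fun g => u g = 3 ∧ v (c - g) = 3)).card ≤ cap := by
  have h := three_floor_sum_le hT hu hv
  have key : ∀ W ≤ 3, ∀ a ≤ 3, ∀ b ≤ 3, W * (3 * if a = 3 ∧ b = 3 then 1 else 0) ≤ W * a * b / 3 := by decide
  refine Nat.le_of_mul_le_mul_left (le_trans ?_ h) hW
  rw [card_filter, mul_sum, mul_sum]
  exact sum_le_sum fun g _ => key W hT.1 (u g) (hu g) (v (c - g)) (hv (c - g))

/-! ### Level sets and the representation function -/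

/-- For level sets `A = {g : P (u g)}`, `B = {h : Q (v h)}`: `r_{A,B}(c) = #{g : P (u g) ∧ Q (v (c − g))}`. [bookkeeping] -/
theorem repCount_levels_eq (P Q : ℕ → Prop) [DecidablePred P] [DecidablePred Q] (c : Λ) :
    repCount (univ.filter fun g => P (u g)) (univ.filter fun h => Q (v h)) c =
      (univ.filter fun g => P (u g) ∧ Q (v (c - g))).card := by
  rw [GW2.repCount_eq_card_filter, filter_filter]
  congr 1
  ext g
  simp only [mem_filter, mem_univ, true_and]

/-- **`N_t` under a cap on the support of `w`.**  If `r_{A,B}(c) ≤ κ` whenever `w c ≥ 1`, then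
`Σ_{s ∈ A+B} min(t, r_{A,B}(s)) ≤ #supp w · min(t, κ) + t · #{w = 0}`. [original] -/
theorem sum_min_repCount_le_of_cap (A B : Finset Λ) (t κ : ℕ) (hcap : ∀ c, 1 ≤ w c → repCount A B c ≤ κ) :
    ∑ s ∈ A + B, min t (repCount A B s) ≤
      (univ.filter (fun c => 1 ≤ w c)).card * min t κ + t * (univ.filter (fun c => w c = 0)).card := by
  calc ∑ s ∈ A + B, min t (repCount A B s)
      ≤ ∑ s, min t (repCount A B s) := sum_le_sum_of_subset_of_nonneg (subset_univ _) (fun _ _ _ => Nat.zero_le _)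
    _ = ∑ s ∈ univ.filter (fun c => 1 ≤ w c), min t (repCount A B s) +
          ∑ s ∈ univ.filter (fun c => ¬ 1 ≤ w c), min t (repCount A B s) :=
        (sum_filter_add_sum_filter_not univ (fun c => 1 ≤ w c) _).symm
    _ ≤ ∑ s ∈ univ.filter (fun c => 1 ≤ w c), min t κ + ∑ s ∈ univ.filter (fun c => ¬ 1 ≤ w c), t := by
        gcongr with s hs s hs
        · exact hcap s (mem_filter.mp hs).2
        · exact min_le_left _ _
    _ = (univ.filter (fun c => 1 ≤ w c)).card * min t κ + t * (univ.filter (fun c => w c = 0)).card := by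
        rw [sum_const, sum_const, smul_eq_mul, smul_eq_mul, mul_comm ((univ.filter fun c => ¬ 1 ≤ w c).card) t]
        congr 2
        exact congrArg card (filter_congr fun c _ => by omega)

/-! ### The Grynkiewicz–Wang row -/

/-- **GW row.**  For finsets `A, B ⊆ Λ` with `r_{A,B} ≤ κ` on `supp w`, a level `t` with `κ < t`, `2 ≤ t ≤ |A|, |B|`: either the floor
`t|A| + t|B| ≤ #supp w·min(t,κ) + t·#{w = 0} + cgw t`, or a divisor `d ≥ 2` of `|Λ|` (order of the period group of the `t`-popular set `S`, which
lies inside `{w = 0}` because `κ < t`) with `|A| + |B| + 1 ≤ #{w = 0} + d + t` and `t|A| + t|B| ≤ t·d + #supp w·min(t,κ) + t·#{w = 0}`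
(tree `GW2.gw_dichotomy` + `sum_min_repCount_le_of_cap`). [original] -/
theorem three_gw_row (A B : Finset Λ) {t κ : ℕ} (hcap : ∀ c, 1 ≤ w c → repCount A B c ≤ κ) (hκt : κ < t)
    (ht : 2 ≤ t) (htA : t ≤ A.card) (htB : t ≤ B.card) :
    t * A.card + t * B.card ≤
        (univ.filter (fun c => 1 ≤ w c)).card * min t κ + t * (univ.filter (fun c => w c = 0)).card + GW2.cgw t ∨
      ∃ d : ℕ, d ∣ Fintype.card Λ ∧ 2 ≤ d ∧
        A.card + B.card + 1 ≤ (univ.filter (fun c => w c = 0)).card + d + t ∧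
        t * A.card + t * B.card ≤
          t * d + ((univ.filter (fun c => 1 ≤ w c)).card * min t κ + t * (univ.filter (fun c => w c = 0)).card) := by
  have hN := sum_min_repCount_le_of_cap (w := w) A B t κ hcap
  rcases GW2.gw_dichotomy A B ht htA htB with hfl | ⟨S, -, hSne, hpop, h2, hkn, -, -, hZ⟩
  · left
    omega
  · right
    -- the popular set misses `supp w`
    have hS0 : S ⊆ univ.filter (fun c => w c = 0) := by
      intro s hs
      rw [mem_filter]
      refine ⟨mem_univ _, ?_⟩
      by_contra h0
      have := hcap s (by omega)
      have := hpop s hs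
      omega
    have hSc := card_le_card hS0
    refine ⟨S.addStab.card, hSne.card_addStab_dvd_card_univ, h2, by omega, ?_⟩
    have hZ' : (t : ℤ) * A.card + t * B.card ≤ t * S.addStab.card + (∑ s ∈ A + B, min t (repCount A B s) : ℕ) := by linarith
    have : t * A.card + t * B.card ≤ t * S.addStab.card + ∑ s ∈ A + B, min t (repCount A B s) := by exact_mod_cast hZ'
    omega

/-! ### Instances for one letter form at `p = 3` -/

/-- Row `(G_u, G_v)` (classes `≥ 2` of both summands; cap `κ = cap`). [original] -/
theorem three_gw_row_GG (hF : FormOKG Λ 3 cap vmin SU SV SW u v w) {t : ℕ} (hκt : cap < t) (ht : 2 ≤ t)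
    (htA : t ≤ (univ.filter (fun g => 2 ≤ u g)).card) (htB : t ≤ (univ.filter (fun h => 2 ≤ v h)).card) :
    t * (univ.filter (fun g => 2 ≤ u g)).card + t * (univ.filter (fun h => 2 ≤ v h)).card ≤
        (univ.filter (fun c => 1 ≤ w c)).card * min t cap + t * (univ.filter (fun c => w c = 0)).card + GW2.cgw t ∨
      ∃ d : ℕ, d ∣ Fintype.card Λ ∧ 2 ≤ d ∧
        (univ.filter (fun g => 2 ≤ u g)).card + (univ.filter (fun h => 2 ≤ v h)).card + 1 ≤
          (univ.filter (fun c => w c = 0)).card + d + t ∧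
        t * (univ.filter (fun g => 2 ≤ u g)).card + t * (univ.filter (fun h => 2 ≤ v h)).card ≤
          t * d + ((univ.filter (fun c => 1 ≤ w c)).card * min t cap + t * (univ.filter (fun c => w c = 0)).card) := by
  refine three_gw_row _ _ (fun c hc => ?_) hκt ht htA htB
  rw [repCount_levels_eq (fun n => 2 ≤ n) (fun n => 2 ≤ n)]
  exact three_heavyheavy_le (hF.2.2.2.2.2 c) hc hF.2.2.2.1 hF.2.2.2.2.1

/-- Row `(F_u, F_v)` (full classes of both summands; cap `κ = ⌊cap/3⌋`). [original] -/
theorem three_gw_row_FF (hF : FormOKG Λ 3 cap vmin SU SV SW u v w) {t : ℕ} (hκt : cap / 3 < t) (ht : 2 ≤ t)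
    (htA : t ≤ (univ.filter (fun g => u g = 3)).card) (htB : t ≤ (univ.filter (fun h => v h = 3)).card) :
    t * (univ.filter (fun g => u g = 3)).card + t * (univ.filter (fun h => v h = 3)).card ≤
        (univ.filter (fun c => 1 ≤ w c)).card * min t (cap / 3) + t * (univ.filter (fun c => w c = 0)).card + GW2.cgw t ∨
      ∃ d : ℕ, d ∣ Fintype.card Λ ∧ 2 ≤ d ∧
        (univ.filter (fun g => u g = 3)).card + (univ.filter (fun h => v h = 3)).card + 1 ≤
          (univ.filter (fun c => w c = 0)).card + d + t ∧
        t * (univ.filter (fun g => u g = 3)).card + t * (univ.filter (fun h => v h = 3)).card ≤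
          t * d + ((univ.filter (fun c => 1 ≤ w c)).card * min t (cap / 3) + t * (univ.filter (fun c => w c = 0)).card) := by
  refine three_gw_row _ _ (fun c hc => ?_) hκt ht htA htB
  rw [repCount_levels_eq (fun n => n = 3) (fun n => n = 3)]
  have := three_fullfull_le (hF.2.2.2.2.2 c) hc hF.2.2.2.1 hF.2.2.2.2.1
  omega

/-- Row `(F_u, G_v)` (full classes of `u`, classes `≥ 2` of `v`; cap `κ = ⌊cap/2⌋`). [original] -/
theorem three_gw_row_FG (hF : FormOKG Λ 3 cap vmin SU SV SW u v w) {t : ℕ} (hκt : cap / 2 < t) (ht : 2 ≤ t)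
    (htA : t ≤ (univ.filter (fun g => u g = 3)).card) (htB : t ≤ (univ.filter (fun h => 2 ≤ v h)).card) :
    t * (univ.filter (fun g => u g = 3)).card + t * (univ.filter (fun h => 2 ≤ v h)).card ≤
        (univ.filter (fun c => 1 ≤ w c)).card * min t (cap / 2) + t * (univ.filter (fun c => w c = 0)).card + GW2.cgw t ∨
      ∃ d : ℕ, d ∣ Fintype.card Λ ∧ 2 ≤ d ∧
        (univ.filter (fun g => u g = 3)).card + (univ.filter (fun h => 2 ≤ v h)).card + 1 ≤
          (univ.filter (fun c => w c = 0)).card + d + t ∧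
        t * (univ.filter (fun g => u g = 3)).card + t * (univ.filter (fun h => 2 ≤ v h)).card ≤
          t * d + ((univ.filter (fun c => 1 ≤ w c)).card * min t (cap / 2) + t * (univ.filter (fun c => w c = 0)).card) := by
  refine three_gw_row _ _ (fun c hc => ?_) hκt ht htA htB
  rw [repCount_levels_eq (fun n => n = 3) (fun n => 2 ≤ n)]
  have := three_fullheavy_le (hF.2.2.2.2.2 c) hc hF.2.2.2.1 hF.2.2.2.2.1
  omega

/-- Row `(G_u, F_v)` (classes `≥ 2` of `u`, full classes of `v`; cap `κ = ⌊cap/2⌋`). [original] -/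
theorem three_gw_row_GF (hF : FormOKG Λ 3 cap vmin SU SV SW u v w) {t : ℕ} (hκt : cap / 2 < t) (ht : 2 ≤ t)
    (htA : t ≤ (univ.filter (fun g => 2 ≤ u g)).card) (htB : t ≤ (univ.filter (fun h => v h = 3)).card) :
    t * (univ.filter (fun g => 2 ≤ u g)).card + t * (univ.filter (fun h => v h = 3)).card ≤
        (univ.filter (fun c => 1 ≤ w c)).card * min t (cap / 2) + t * (univ.filter (fun c => w c = 0)).card + GW2.cgw t ∨
      ∃ d : ℕ, d ∣ Fintype.card Λ ∧ 2 ≤ d ∧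
        (univ.filter (fun g => 2 ≤ u g)).card + (univ.filter (fun h => v h = 3)).card + 1 ≤
          (univ.filter (fun c => w c = 0)).card + d + t ∧
        t * (univ.filter (fun g => 2 ≤ u g)).card + t * (univ.filter (fun h => v h = 3)).card ≤
          t * d + ((univ.filter (fun c => 1 ≤ w c)).card * min t (cap / 2) + t * (univ.filter (fun c => w c = 0)).card) := by
  refine three_gw_row _ _ (fun c hc => ?_) hκt ht htA htB
  rw [repCount_levels_eq (fun n => 2 ≤ n) (fun n => n = 3)]
  have := three_heavyfull_le (hF.2.2.2.2.2 c) hc hF.2.2.2.1 hF.2.2.2.2.1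
  omega

end FPQ

end Summit.MatrixMultiplication.MatrixMultiplication.Theorems
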